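import Summits.CriticalPhenomena.PercolationContinuityZ3.Theorems.PercNearOneGluingNoHeavyRsw3InvasionGreedy
import HarnessLib

/-!
# RSW3 lane (P2, gen 26): INVASION PERCOLATION II — locality of the break-out history and measurability
# (every locally finite graph on a countable vertex set, every label field)

builds on p205010 (kernel theorem, internal audit signed; external expert review pending) — NOT used in this file.

Cell `prim-rsw3`, prover seat `prim-rsw3-p2` (gen 26), memo `run/shared/lean/prim/rsw3/P2-RSWLITE.md` §33.  Support file
(`--supports stmt-CriticalPhenomena-4575`); no definitions, no named facts, no sorries.  Two technical inputs of
Chayes–Chayes–Newman's proof of their Theorem 3.2 ("Observe that the event `s` [break-out of `Λ_m` at the site `s`] depends only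
on the distribution of values assigned to those bonds with both endpoints in `Λ_m` …"):

* §1 **LOCALITY.** If two label fields `U, U'` agree on every edge touching the finite set `Λ` (`∃ x ∈ Λ, x ∈ e`), then up to
  the break-out time `n_Λ` the two invasions coincide (`invasion_congr_of_agree`), as do the accepted labels before `n_Λ`
  (`acceptedLabel_congr_of_agree`), the break-out time itself (`exitIndex_congr_of_agree`), the break-out vertex
  (`exitVertex_congr_of_agree`) and CCN's count `M_{n_Λ}(y)` of labels `> y` accepted before break-out (`badCount_exitIndex_congr_of_agree`).
* §2 **MEASURABILITY** on the label space `Sym2 V → ℝ` (product σ-algebra): the events `{minDarts = S}`, `{newDart = v}`,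
  `{I_n = J}`, `{y < x_n}`, `{M_n(y) = c}`, `{n_Λ = N}`, `{exitVertex = s}` are measurable (`measurable_minDarts_eq`, …,
  `measurable_exitVertex_eq`), by the closure of measurable predicates under countable Boolean operations (Mathlib's
  `Measurable.and/.forall/.exists`) — the tie-breaking choice enters only through the finite set of minimising darts.

References: J. T. Chayes, L. Chayes, C. M. Newman, Comm. Math. Phys. 101 (1985) 383–407, §3 proof of Thm 3.2 [ChayesChayesNewman1985].
-/

noncomputable section

namespace Summit.CriticalPhenomena.PercolationContinuityZ3.Theorems.Rsw3

open Finset MeasureTheory Literature.Probability.Percolation Literature.Probability.Percolation.Invasion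

variable {V : Type*} [DecidableEq V] {G : SimpleGraph V} [G.LocallyFinite]

/-! ## §1 Locality of the history up to break-out -/

/-- Two label fields that agree on the edges touching `Λ` have the same minimising darts from any region `I ⊆ Λ`.
[cite: ChayesChayesNewman1985, §3 proof of Thm 3.2 (the break-out event depends only on the bonds of Λ_m)] -/
theorem minDarts_congr_of_agree {U U' : Sym2 V → ℝ} {Λ I : Finset V} (hI : I ⊆ Λ)
    (h : ∀ e : Sym2 V, (∃ x ∈ Λ, x ∈ e) → U e = U' e) : minDarts G U I = minDarts G U' I := by
  have hlab : ∀ b ∈ boundaryDarts G I, U s(b.1, b.2) = U' s(b.1, b.2) := fun b hb =>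
    h _ ⟨b.1, hI ((mem_boundaryDarts G).1 hb).1, Sym2.mem_mk_left _ _⟩
  ext a
  simp only [mem_minDarts]
  constructor
  · rintro ⟨ha, hmin⟩
    exact ⟨ha, fun b hb => by rw [← hlab a ha, ← hlab b hb]; exact hmin b hb⟩
  · rintro ⟨ha, hmin⟩
    exact ⟨ha, fun b hb => by rw [hlab a ha, hlab b hb]; exact hmin b hb⟩

/-- Hence the same absorbed dart. [cite: ChayesChayesNewman1985, §3 proof of Thm 3.2] -/
theorem newDart_congr_of_agree {U U' : Sym2 V → ℝ} {Λ I : Finset V} (hI : I ⊆ Λ)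
    (h : ∀ e : Sym2 V, (∃ x ∈ Λ, x ∈ e) → U e = U' e) : newDart G U I = newDart G U' I :=
  newDart_congr G (minDarts_congr_of_agree hI h)

/-- **Locality of the invasion up to break-out**: if `U` and `U'` agree on the edges touching `Λ`, then `I_n(U) = I_n(U')` for every
`n ≤ n_Λ(U)`. [cite: ChayesChayesNewman1985, §3 proof of Thm 3.2 (the break-out event depends only on the bonds of Λ_m)] -/
theorem invasion_congr_of_agree {U U' : Sym2 V → ℝ} {o : V} {Λ : Finset V} (hex : ∃ n, ¬ invasion G U o n ⊆ Λ)
    (h : ∀ e : Sym2 V, (∃ x ∈ Λ, x ∈ e) → U e = U' e) {n : ℕ} (hn : n ≤ exitIndex G U o Λ) :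
    invasion G U o n = invasion G U' o n := by
  induction n with
  | zero => rfl
  | succ n ih =>
    have hsub : invasion G U o n ⊆ Λ := (exitIndex_spec G hex).2 n (Nat.lt_of_succ_le hn)
    rw [invasion_succ, invasion_succ, ← ih (Nat.le_of_succ_le hn)]
    cases hd : newDart G U (invasion G U o n) with
    | none =>
      rw [step_of_eq_none G hd, step_of_eq_none G]
      rwa [← newDart_congr_of_agree hsub h]
    | some a =>
      rw [step_of_eq_some G hd, step_of_eq_some G]
      rwa [← newDart_congr_of_agree hsub h]

/-- Locality of the accepted labels before break-out: `x_n(U) = x_n(U')` for `n < n_Λ(U)`. [cite: ChayesChayesNewman1985, §3 proof of Thm 3.2] -/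
theorem acceptedLabel_congr_of_agree {U U' : Sym2 V → ℝ} {o : V} {Λ : Finset V} (hex : ∃ n, ¬ invasion G U o n ⊆ Λ)
    (h : ∀ e : Sym2 V, (∃ x ∈ Λ, x ∈ e) → U e = U' e) {n : ℕ} (hn : n < exitIndex G U o Λ) :
    acceptedLabel G U o n = acceptedLabel G U' o n := by
  have hsub : invasion G U o n ⊆ Λ := (exitIndex_spec G hex).2 n hn
  have hI : invasion G U o n = invasion G U' o n := invasion_congr_of_agree hex h hn.le
  cases hd : newDart G U (invasion G U o n) with
  | none =>
    have hd' : newDart G U' (invasion G U' o n) = none := by rwa [← hI, ← newDart_congr_of_agree hsub h]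
    simp only [acceptedLabel, hd, hd']
  | some a =>
    have hd' : newDart G U' (invasion G U' o n) = some a := by rwa [← hI, ← newDart_congr_of_agree hsub h]
    rw [acceptedLabel_of_eq_some G hd, acceptedLabel_of_eq_some G hd']
    exact h _ ⟨a.1, hsub (fst_mem_of_newDart hd), Sym2.mem_mk_left _ _⟩

/-- Locality of the break-out time: `n_Λ(U') = n_Λ(U)`. [cite: ChayesChayesNewman1985, §3 proof of Thm 3.2] -/
theorem exitIndex_congr_of_agree {U U' : Sym2 V → ℝ} {o : V} {Λ : Finset V} (hex : ∃ n, ¬ invasion G U o n ⊆ Λ)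
    (h : ∀ e : Sym2 V, (∃ x ∈ Λ, x ∈ e) → U e = U' e) : exitIndex G U' o Λ = exitIndex G U o Λ := by
  obtain ⟨hN, hlt⟩ := exitIndex_spec G hex
  have hN' : ¬ invasion G U' o (exitIndex G U o Λ) ⊆ Λ := by rwa [← invasion_congr_of_agree hex h le_rfl]
  rw [exitIndex_eq_iff G ⟨_, hN'⟩]
  exact ⟨hN', fun n hn => by rw [← invasion_congr_of_agree hex h hn.le]; exact hlt n hn⟩

/-- Locality of the break-out vertex, when `o ∈ Λ`. [cite: ChayesChayesNewman1985, §3 proof of Thm 3.2] -/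
theorem exitVertex_congr_of_agree {U U' : Sym2 V → ℝ} {o : V} {Λ : Finset V} (ho : o ∈ Λ)
    (hex : ∃ n, ¬ invasion G U o n ⊆ Λ) (h : ∀ e : Sym2 V, (∃ x ∈ Λ, x ∈ e) → U e = U' e) :
    exitVertex G U' o Λ = exitVertex G U o Λ := by
  have hpos : 0 < exitIndex G U o Λ := by
    rcases Nat.eq_zero_or_pos (exitIndex G U o Λ) with h0 | h0
    · exact absurd (by rw [h0, invasion_zero]; exact singleton_subset_iff.2 ho) (exitIndex_spec G hex).1
    · exact h0
  have hlt : exitIndex G U o Λ - 1 < exitIndex G U o Λ := Nat.sub_lt hpos one_pos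
  have hsub : invasion G U o (exitIndex G U o Λ - 1) ⊆ Λ := (exitIndex_spec G hex).2 _ hlt
  have hI : invasion G U o (exitIndex G U o Λ - 1) = invasion G U' o (exitIndex G U' o Λ - 1) := by
    rw [exitIndex_congr_of_agree hex h]; exact invasion_congr_of_agree hex h hlt.le
  have hD : newDart G U (invasion G U o (exitIndex G U o Λ - 1)) =
      newDart G U' (invasion G U' o (exitIndex G U' o Λ - 1)) := by
    rw [← hI]; exact newDart_congr_of_agree hsub h
  simp only [exitVertex, hD]

/-- Locality of CCN's count `M_{n_Λ}(y)` (labels `> y` accepted before break-out). [cite: ChayesChayesNewman1985, §3 proof of Thm 3.2 (M_{n_Λ})] -/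
theorem badCount_exitIndex_congr_of_agree {U U' : Sym2 V → ℝ} {o : V} {Λ : Finset V} (y : ℝ)
    (hex : ∃ n, ¬ invasion G U o n ⊆ Λ) (h : ∀ e : Sym2 V, (∃ x ∈ Λ, x ∈ e) → U e = U' e) :
    badCount G U' o y (exitIndex G U' o Λ) = badCount G U o y (exitIndex G U o Λ) := by
  rw [exitIndex_congr_of_agree hex h, badCount, badCount]
  congr 1
  refine filter_congr fun j hj => ?_
  rw [acceptedLabel_congr_of_agree hex h (mem_range.1 hj)]

/-! ## §2 Measurability on the label space -/

section Measurability

variable [Countable V]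

omit [DecidableEq V] [G.LocallyFinite] [Countable V] in
/-- Each label is a measurable function of the label field. [folklore] -/
theorem measurable_label (e : Sym2 V) : Measurable fun U : Sym2 V → ℝ => U e :=
  measurable_pi_apply e

omit [DecidableEq V] [G.LocallyFinite] [Countable V] in
/-- Label comparisons are measurable predicates. [folklore] -/
theorem measurable_label_le (e e' : Sym2 V) : Measurable fun U : Sym2 V → ℝ => U e ≤ U e' :=
  measurableSet_setOf.1 (measurableSet_le (measurable_label e) (measurable_label e'))

/-- The set of minimising darts is a measurable function of the labels: `{U | minDarts G U I = S}` is measurable.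
[cite: ChayesChayesNewman1985, §2 (the model)] -/
theorem measurable_minDarts_eq (I : Finset V) (S : Finset (V × V)) :
    Measurable fun U : Sym2 V → ℝ => minDarts G U I = S := by
  have : (fun U : Sym2 V → ℝ => minDarts G U I = S) = fun U => ∀ a : V × V,
      (a ∈ boundaryDarts G I ∧ ∀ b : V × V, b ∈ boundaryDarts G I → U s(a.1, a.2) ≤ U s(b.1, b.2)) ↔ a ∈ S := by
    ext U
    simp only [Finset.ext_iff, mem_minDarts]
  rw [this]
  refine Measurable.forall fun a => Measurable.iff ?_ measurable_const
  exact measurable_const.and (Measurable.forall fun b => measurable_const.imp (measurable_label_le _ _))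

/-- The absorbed dart is a measurable function of the labels: `{U | newDart G U I = v}` is measurable (the tie-break enters only
through the finite set of minimisers). [cite: ChayesChayesNewman1985, §2 (the model)] -/
theorem measurable_newDart_eq (I : Finset V) (v : Option (V × V)) :
    Measurable fun U : Sym2 V → ℝ => newDart G U I = v := by
  have : (fun U : Sym2 V → ℝ => newDart G U I = v) = fun U => ∃ S : Finset (V × V), minDarts G U I = S ∧
      (if h : S.Nonempty then some h.choose else none) = v := by
    ext U
    constructor
    · intro hv; exact ⟨_, rfl, hv⟩
    · rintro ⟨S, hS, hv⟩; subst hS; exact hv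
  rw [this]
  exact Measurable.exists fun S => (measurable_minDarts_eq I S).and measurable_const

/-- One step is a measurable function of the labels. [cite: ChayesChayesNewman1985, §2 (the model)] -/
theorem measurable_step_eq (I J : Finset V) : Measurable fun U : Sym2 V → ℝ => step G U I = J := by
  have : (fun U : Sym2 V → ℝ => step G U I = J) = fun U => ∃ v : Option (V × V), newDart G U I = v ∧
      (match v with | some a => insert a.2 I | none => I) = J := by
    ext U
    constructor
    · intro hJ
      refine ⟨newDart G U I, rfl, ?_⟩
      cases hd : newDart G U I with
      | none => simpa [step, hd] using hJ
      | some a => simpa [step, hd] using hJ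
    · rintro ⟨v, hv, hJ⟩
      cases v with
      | none => simpa [step, hv] using hJ
      | some a => simpa [step, hv] using hJ
  rw [this]
  exact Measurable.exists fun v => (measurable_newDart_eq I v).and measurable_const

/-- **The invaded region at time `n` is a measurable function of the labels**: `{U | I_n(U) = J}` is measurable.
[cite: ChayesChayesNewman1985, §2 (the model)] -/
theorem measurable_invasion_eq (o : V) (n : ℕ) (J : Finset V) :
    Measurable fun U : Sym2 V → ℝ => invasion G U o n = J := by
  induction n generalizing J with
  | zero => simp only [invasion_zero]; exact measurable_const
  | succ n ih =>
    have : (fun U : Sym2 V → ℝ => invasion G U o (n + 1) = J) =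
        fun U => ∃ I : Finset V, invasion G U o n = I ∧ step G U I = J := by
      ext U
      simp only [invasion_succ]
      exact ⟨fun h => ⟨_, rfl, h⟩, fun ⟨I, hI, h⟩ => hI ▸ h⟩
    rw [this]
    exact Measurable.exists fun I => (ih I).and (measurable_step_eq I J)

/-- Any property of the invaded region at time `n` defines a measurable event. [cite: ChayesChayesNewman1985, §2 (the model)] -/
theorem measurable_invasion_prop (o : V) (n : ℕ) (P : Finset V → Prop) :
    Measurable fun U : Sym2 V → ℝ => P (invasion G U o n) := by
  have : (fun U : Sym2 V → ℝ => P (invasion G U o n)) = fun U => ∃ I : Finset V, invasion G U o n = I ∧ P I := by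
    ext U; exact ⟨fun h => ⟨_, rfl, h⟩, fun ⟨I, hI, h⟩ => hI ▸ h⟩
  rw [this]
  exact Measurable.exists fun I => (measurable_invasion_eq o n I).and measurable_const

/-- `{U | y < x_n(U)}` is measurable. [cite: ChayesChayesNewman1985, §2 (x_n)] -/
theorem measurable_lt_acceptedLabel (o : V) (y : ℝ) (n : ℕ) :
    Measurable fun U : Sym2 V → ℝ => y < acceptedLabel G U o n := by
  have : (fun U : Sym2 V → ℝ => y < acceptedLabel G U o n) = fun U => ∃ I : Finset V, invasion G U o n = I ∧
      ((∃ a : V × V, newDart G U I = some a ∧ y < U s(a.1, a.2)) ∨ (newDart G U I = none ∧ y < 0)) := by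
    ext U
    constructor
    · intro h
      refine ⟨_, rfl, ?_⟩
      cases hd : newDart G U (invasion G U o n) with
      | none => right; exact ⟨rfl, by simpa [acceptedLabel, hd] using h⟩
      | some a => left; exact ⟨a, rfl, by rwa [acceptedLabel_of_eq_some G hd] at h⟩
    · rintro ⟨I, hI, h⟩
      subst hI
      rcases h with ⟨a, ha, h⟩ | ⟨hnone, h⟩
      · rwa [acceptedLabel_of_eq_some G ha]
      · simpa [acceptedLabel, hnone] using h
  rw [this]
  refine Measurable.exists fun I => (measurable_invasion_eq o n I).and (Measurable.or ?_ ?_)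
  · exact Measurable.exists fun a => (measurable_newDart_eq I _).and
      (measurableSet_setOf.1 (measurableSet_lt measurable_const (measurable_label _)))
  · exact (measurable_newDart_eq I none).and measurable_const

/-- CCN's `M_n(y)` is a measurable function of the labels. [cite: ChayesChayesNewman1985, §3 eq. (3.4)] -/
theorem measurable_badCount (o : V) (y : ℝ) (n : ℕ) : Measurable fun U : Sym2 V → ℝ => badCount G U o y n := by
  refine measurable_to_countable' fun c => ?_
  have : (fun U : Sym2 V → ℝ => badCount G U o y n) ⁻¹' {c} = {U | ∃ T : Finset ℕ, T.card = c ∧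
      ∀ j : ℕ, j ∈ T ↔ (j < n ∧ y < acceptedLabel G U o j)} := by
    ext U
    simp only [Set.mem_preimage, Set.mem_singleton_iff, Set.mem_setOf_eq, badCount]
    constructor
    · intro h
      exact ⟨_, h, fun j => by simp only [mem_filter, mem_range]⟩
    · rintro ⟨T, hT, hmem⟩
      have : (range n).filter (fun j => y < acceptedLabel G U o j) = T := by
        ext j; simp only [mem_filter, mem_range, hmem]
      rw [this, hT]
  rw [this]
  exact measurableSet_setOf.2 (Measurable.exists fun T => measurable_const.and
    (Measurable.forall fun j => measurable_const.iff (measurable_const.and (measurable_lt_acceptedLabel o y j))))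

/-- The break-out time `n_Λ` is a measurable function of the labels. [cite: ChayesChayesNewman1985, §3 proof of Thm 3.2 (n_Λ is a stopping time)] -/
theorem measurable_exitIndex (o : V) (Λ : Finset V) : Measurable fun U : Sym2 V → ℝ => exitIndex G U o Λ := by
  classical
  refine measurable_to_countable' fun N => ?_
  have hsub : ∀ n, Measurable fun U : Sym2 V → ℝ => invasion G U o n ⊆ Λ := fun n =>
    measurable_invasion_prop o n (· ⊆ Λ)
  have : (fun U : Sym2 V → ℝ => exitIndex G U o Λ) ⁻¹' {N} = {U | ((∃ n, ¬ invasion G U o n ⊆ Λ) ∧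
      ¬ invasion G U o N ⊆ Λ ∧ ∀ n, n < N → invasion G U o n ⊆ Λ) ∨ ((¬ ∃ n, ¬ invasion G U o n ⊆ Λ) ∧ N = 0)} := by
    ext U
    simp only [Set.mem_preimage, Set.mem_singleton_iff, Set.mem_setOf_eq]
    by_cases hex : ∃ n, ¬ invasion G U o n ⊆ Λ
    · rw [exitIndex_eq_iff G hex]
      simp only [hex, true_and, not_true_eq_false, false_and, or_false]
    · simp only [exitIndex, hex, false_and, not_false_eq_true, true_and, false_or]
      exact eq_comm
  rw [this]
  refine measurableSet_setOf.2 (Measurable.or ?_ ?_)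
  · exact (Measurable.exists fun n => (hsub n).not).and ((hsub N).not.and
      (Measurable.forall fun n => measurable_const.imp (hsub n)))
  · exact (Measurable.exists fun n => (hsub n).not).not.and measurable_const

/-- `{U | n_Λ(U) = N}` is measurable. [cite: ChayesChayesNewman1985, §3 proof of Thm 3.2] -/
theorem measurable_exitIndex_eq (o : V) (Λ : Finset V) (N : ℕ) :
    Measurable fun U : Sym2 V → ℝ => exitIndex G U o Λ = N :=
  (measurable_exitIndex o Λ).eq_const N

/-- The break-out vertex is a measurable function of the labels: `{U | exitVertex = s}` is measurable.
[cite: ChayesChayesNewman1985, §3 proof of Thm 3.2 (the events {break-out at s})] -/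
theorem measurable_exitVertex_eq (o : V) (Λ : Finset V) (s : V) :
    Measurable fun U : Sym2 V → ℝ => exitVertex G U o Λ = s := by
  have : (fun U : Sym2 V → ℝ => exitVertex G U o Λ = s) = fun U => ∃ N : ℕ, exitIndex G U o Λ = N ∧
      ∃ I : Finset V, invasion G U o (N - 1) = I ∧
        ((∃ a : V × V, newDart G U I = some a ∧ a.2 = s) ∨ (newDart G U I = none ∧ o = s)) := by
    ext U
    constructor
    · intro h
      refine ⟨_, rfl, _, rfl, ?_⟩
      cases hd : newDart G U (invasion G U o (exitIndex G U o Λ - 1)) with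
      | none => right; exact ⟨rfl, by simpa [exitVertex, hd] using h⟩
      | some a => left; exact ⟨a, rfl, by rwa [exitVertex_of_eq_some G hd] at h⟩
    · rintro ⟨N, hN, I, hI, h⟩
      subst hN; subst hI
      rcases h with ⟨a, ha, h⟩ | ⟨hnone, h⟩
      · rwa [exitVertex_of_eq_some G ha]
      · simpa [exitVertex, hnone] using h
  rw [this]
  refine Measurable.exists fun N => (measurable_exitIndex_eq o Λ N).and
    (Measurable.exists fun I => (measurable_invasion_eq o _ I).and (Measurable.or ?_ ?_))
  · exact Measurable.exists fun a => (measurable_newDart_eq I _).and measurable_const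
  · exact (measurable_newDart_eq I none).and measurable_const

end Measurability

end Summit.CriticalPhenomena.PercolationContinuityZ3.Theorems.Rsw3
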